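import Summits.BirchSwinnertonDyer.BirchSwinnertonDyer.Theorems.EisensteinPrimesResidualDevissageNonsplitLambdaIdentityOfPrimitive
import Summits.BirchSwinnertonDyer.BirchSwinnertonDyer.Theorems.EisensteinPrimesKellerYinLemma511NonsplitOfPrimitive
import Summits.BirchSwinnertonDyer.BirchSwinnertonDyer.Theorems.EisensteinPrimesXAcImprimitiveNoPTorsionOfPoitouTateAt
import HarnessLib

/-!
# Keller–Yin Thm. 1.4.1's λ-identity WITH EQUALITY at a non-split multiplicative Eisenstein datum WITHOUT CGLS Prop. 1.2.5 / Prop. 14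
# by name: `λ(𝔛^{Sf}_f) = λ(𝔛^{Sf}_{θsub}) + λ(𝔛^{Sf}_{θquot})` from Cor. 1.2.6 ×2, Milne I 4.10 (a), Greenberg 2006 Props. 4.1/4.2/3.2
# and the PRIMITIVE unramified triples (cell `bsd-eis`, width seat `bsd-line-x2-p2` gen 27; crux 4 `BSDpOnCellC`
# stmt-BirchSwinnertonDyer-19034, line telescope v21 UNCHANGED; P4-c of the C2 programme, evidence #59)

The prop125/prop14-DROP twin of x2-p2 g18's `XAcImprimitiveNoPTorsion.lambdaInvariant_xAc_eq_add_of_not_split_ofPoitouTateAt`: binders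
`(hprop125 : prop125_…) (hfact : prop14_…)` REPLACED by the primitive unramified triples `hprimsub hprimquot` of the residual pair
(the `Red W p` binder, only used by g4's internal choice of a rational line, leaves too); proof = this seat's P4-a
(`lambdaInvariant_le_add_of_isResidualPairOver_of_not_split_of_primitive`, p-pending) `.2.2` fed the no-p-torsion of `𝔛^{Sf}_f`
(g18's `xAc_smul_eq_zero_imp_ofPoitouTateAt`, unchanged) with `𝔛^{Sf}_f` f.g. torsion `μ = 0` from P4-b
(`xAc_moduleFinite_isTorsion_muInvariant_of_primitive_of_not_split`).

HONEST FRAMING: one theorem (no definition, no named fact, no `sorry`, no instance); CONDITIONAL on Cor. 1.2.6 ×2, `hX h41 h42 h32` (tree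
theorems at the head) and the primitive triples; the original stays untouched; closes no stub, moves no count (27 names by name of record);
BSD is proved for no curve.
-/

set_option autoImplicit false
set_option linter.dupNamespace false -- the summit namespace `…BirchSwinnertonDyer.BirchSwinnertonDyer.Theorems` (Sub = Summit, D-0017) trips it

noncomputable section

open scoped Classical
open NumberField IsDedekindDomain Field WeierstrassCurve
open Literature.NumberTheory.EllipticCurves Literature.NumberTheory.EllipticCurves.GreenbergSelmer
  Literature.NumberTheory.EllipticCurves.GreenbergVatsal2000 Literature.NumberTheory.GaloisRepresentations
  Literature.NumberTheory.EllipticCurves.KellerYin2024 Literature.NumberTheory.EllipticCurves.IwasawaDual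
  Literature.NumberTheory.EllipticCurves.Castella2018.AcSelmer Literature.NumberTheory.EllipticCurves.Rank1Residual
  Literature.NumberTheory.EllipticCurves.CastellaGrossiLeeSkinner2022
  Literature.NumberTheory.IwasawaTheory Literature.NumberTheory.IwasawaTheory.Greenberg2016
  Literature.NumberTheory.IwasawaTheory.Greenberg2006
  Summit.BirchSwinnertonDyer.BirchSwinnertonDyer.Theorems

namespace Summit.BirchSwinnertonDyer.BirchSwinnertonDyer.Theorems.XAcLambdaIdentityOfPrimitive

variable {K : Type} [Field K] [NumberField K] {p : ℕ} [hp : Fact p.Prime]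

/-- **[prop125/prop14-DROP twin of `XAcImprimitiveNoPTorsion.lambdaInvariant_xAc_eq_add_of_not_split_ofPoitouTateAt`.]**
**`λ(𝔛^{Sf}_f) = λ(𝔛^{Sf}_{θsub}) + λ(𝔛^{Sf}_{θquot})` at every NON-SPLIT multiplicative Eisenstein datum and every residual pair
`(θsub, θquot)` of `E_K[p]` over `K`, for all strict dual data `Dsub`, `Dquot`** — GRANTED CGLS Cor. 1.2.6 ×2 (`hlift`, `hlocal`), Milne
ADT I 4.10 (a) at totally complex fields (`hX`), Greenberg 2006 Props. 4.1/4.2/3.2 (`h41 h42 h32`) BY NAME, and the PRIMITIVE unramified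
(f.g., torsion, `μ = 0`) triples `hprimsub`, `hprimquot` of the two characters (Thm. 1.2.2's conclusion, the char-MC engines' currency).
Datum: `W/ℚ` globally minimal, `2 < p`, `p ‖ N` NON-split, `K` imaginary quadratic Heegner for `N_E`, `p = v v̄` split, `κ` anticyclotomic
with generator `γ`, `Sf` = places over `N_E` off `p`. Keller–Yin Thm. 1.4.1 «whose proof still works in the multiplicative reduction
setting» (§5.1), now modulo published inputs NOT including CGLS Prop. 1.2.5.
[cite: KellerYin2024, Thm. 1.4.1, Lemma 5.1.1 and §5.1 (arXiv:2402.12781v2 TeX L1087–1098, L1744–1778)]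
[cite: CastellaGrossiLeeSkinner2022, §1.2 Thm. 1.2.2, Prop. 1.2.5 (proof), Cor. 1.2.6, §1.4 Props. 1.4.1–1.4.2, Cor. 1.4.3 (arXiv:2008.02571)]
[cite: Greenberg2016Selmer, Prop. 4.1.1 (c)] [cite: Greenberg2006, Props. 3.2, 4.1, 4.2] [cite: MilneADT2006, I Thm. 4.10 (a)] -/
theorem lambdaInvariant_xAc_eq_add_of_not_split_of_primitive_ofPoitouTateAt
    (hlift : cor126_residualCharacter_globalLift) (hlocal : cor126_residualCharacter_localSurjective)
    (hX : ∀ (L : Type) [Field L] [NumberField L] [IsTotallyComplex L] (S : Set (HeightOneSpectrum (𝓞 L))),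
      S.Finite → Literature.NumberTheory.GaloisCohomology.poitouTate_shaRestricted_tateDual_natural_at L S)
    (h41 : prop41_globalEulerPoincareCorank) (h42 : prop42_localEulerPoincareCorank) (h32 : prop32_cohomology_isCofinitelyGenerated)
    (W : WeierstrassCurve ℚ) [W.IsElliptic] [W.IsGloballyMinimal]
    (K : Type) [Field K] [NumberField K] {v : HeightOneSpectrum (𝓞 K)} (vbar : HeightOneSpectrum (𝓞 K))
    (κ : ZpExtension K p) (γ : absoluteGaloisGroup K) [Fact (κ.IsTopGenerator γ)]
    (Sf : Finset (HeightOneSpectrum (𝓞 K)))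
    (hp2 : 2 < p) (hmult : Mult W p) (hns : ¬ W.HasSplitMultiplicativeReductionAtPrime p)
    (hK : IsImaginaryQuadratic K) (hH : SatisfiesHeegnerHypothesis (W.conductorNorm ℤ) K)
    (hsplit : ((Ideal.span {(p : ℤ)}).primesOver (𝓞 K)).ncard = 2)
    (hv : ((p : ℕ) : 𝓞 K) ∈ v.asIdeal) (hvbar : ((p : ℕ) : 𝓞 K) ∈ vbar.asIdeal) (hne : vbar ≠ v) (hκ : κ.IsAnticyclotomic)
    (hSf : ∀ w : HeightOneSpectrum (𝓞 K), w ∈ Sf ↔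
      (((W.conductorNorm ℤ : ℤ) : 𝓞 K) ∈ w.asIdeal ∧ ((p : ℕ) : 𝓞 K) ∉ w.asIdeal))
    (θsub θquot : FramedGaloisRep K (padicCoeffIntegers (∅ : Set (PadicAlgCl p))) 1)
    (hpair : IsResidualPairOver (W.baseChange K) p θsub θquot)
    (hprimsub : ∀ D : DatumDualData κ γ (charModule (∅ : Set (PadicAlgCl p)) θsub)
      (Castella2018.AcSelmer.bdpData (charModule (∅ : Set (PadicAlgCl p)) θsub) p vbar) (∅ : Set (HeightOneSpectrum (𝓞 K))),
      Module.Finite (IwasawaAlgebra p) D.X ∧ Module.IsTorsion (IwasawaAlgebra p) D.X ∧ muInvariant p D.X = 0)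
    (hprimquot : ∀ D : DatumDualData κ γ (charModule (∅ : Set (PadicAlgCl p)) θquot)
      (Castella2018.AcSelmer.bdpData (charModule (∅ : Set (PadicAlgCl p)) θquot) p vbar) (∅ : Set (HeightOneSpectrum (𝓞 K))),
      Module.Finite (IwasawaAlgebra p) D.X ∧ Module.IsTorsion (IwasawaAlgebra p) D.X ∧ muInvariant p D.X = 0)
    (Dsub : GrDualData κ (charModule (∅ : Set (PadicAlgCl p)) θsub) vbar (↑Sf : Set (HeightOneSpectrum (𝓞 K))) γ)
    (Dquot : GrDualData κ (charModule (∅ : Set (PadicAlgCl p)) θquot) vbar (↑Sf : Set (HeightOneSpectrum (𝓞 K))) γ) :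
    lambdaInvariant p (XAc (W.baseChange K) p κ vbar (↑Sf : Set (HeightOneSpectrum (𝓞 K))) γ) =
      lambdaInvariant p Dsub.X + lambdaInvariant p Dquot.X := by
  obtain ⟨hXfin, hXtor, hμ⟩ :=
    KellerYinLemma511NonsplitOfPrimitive.xAc_moduleFinite_isTorsion_muInvariant_of_primitive_of_not_split W K vbar κ γ Sf hp2 hmult
      hns hK hH hsplit hvbar hκ hSf θsub θquot hpair hprimsub hprimquot
  exact (ResidualDevissageNonsplitLambdaIdentityOfPrimitive.lambdaInvariant_le_add_of_isResidualPairOver_of_not_split_of_primitive hX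
    h41 h42 h32 hlift hlocal W K vbar κ γ Sf hp2 hmult hns hK hH hsplit hvbar hκ hSf θsub θquot hpair hprimsub hprimquot Dsub Dquot).2.2
    (fun x hx ↦ XAcImprimitiveNoPTorsion.xAc_smul_eq_zero_imp_ofPoitouTateAt hX h41 h42 h32 W hp2 hK hH hv hvbar hne κ hκ γ Sf hSf
      hXfin hXtor hμ x hx)

end Summit.BirchSwinnertonDyer.BirchSwinnertonDyer.Theorems.XAcLambdaIdentityOfPrimitive

end
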